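import Literature.NumberTheory.EllipticCurves.EisensteinNewformLevelRaising
import Literature.NumberTheory.EllipticCurves.EisensteinNewformLevelRaisingCuspidalCongruenceProofs
import Literature.NumberTheory.EllipticCurves.EisensteinSeriesNebentypusLevelRaisedOddPrimeProofs
import Literature.NumberTheory.EllipticCurves.EisensteinNewformLevelRaisingDictionaryProofs
import Literature.NumberTheory.EllipticCurves.EisensteinNewformLevelRaisingOddReductionProofs
import HarnessLib

/-!
# Billerey–Menares 2016, Thm. 2.2 at every odd prime: the whole printed proof, assembled, modulo
# its one non-elementary input "the reduction `F` of `E` modulo `λ` is a cuspidal form"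

Topic `Literature/NumberTheory/EllipticCurves`; namespace `Literature.NumberTheory.EllipticCurves`.
THEOREMS ONLY (no definition, no named fact; D-0026).  A proofs-only companion of the named fact
`Literature.NumberTheory.EllipticCurves.BillereyMenares2016_thm22_exists_newform_odd`
(`EisensteinNewformLevelRaising.lean`): N. Billerey, R. Menares, *On the modularity of reducible
mod `l` Galois representations*, Math. Res. Lett. 23 (2016) 15–41, §2, Thm. 2.2 (p. 7).

## What is proved (`BillereyMenares2016_thm22_exists_newform_odd_of_cuspidalCongruence`)

The printed proof of Thm. 2.2 (p. 7) runs: (1) form `E = E_k^{𝟙,ε₀} - α_M E_k^{𝟙,ε₀}`;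
(2) by Prop. 1.2 all the constant terms of `E ∣_k γ` are divisible by `λ` under the hypothesis on
`(B_{k,ε₀}/2k)(ε₀(M)M^k - 1)`; (3) "therefore the reduction `F` of `E` modulo `λ` is a cuspidal
eigenform"; (4) Deligne–Serre's lifting lemma gives an eigenform `f ∈ S_k(Γ₀(NM), ε₀)` with
`a_q ≡ 1 + ε(q)q^{k-1}`; (5)–(6) [passage to the newform and the primes `q ∈ {l, M}`, implicit in
"arises from"]; (0) the dictionary between `η̄ = εχ_l^b` and `(N, k, ε₀)` (p. 7, before Rem. 2.1).

Every step except (3) is a theorem of the tree: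

* (0) `exists_dirichletCharacter_of_padicCharacter` (`…DictionaryProofs`);
* (1)–(2) `ModularForms.eisensteinLevelRaised` and
  `ModularForms.exists_tendsto_eisensteinLevelRaised_slash_valuation_lt_one_odd`
  (`EisensteinSeriesNebentypusLevelRaised{,LargeWeight,OddPrime}`; all odd `p`, all the weights
  `k ∈ {p, p + 1} ∪ [3, p - 1]`, the von Staudt corner included);
* (4) `ModularForms.DeligneSerreLift.exists_eigenform_of_congruence`
  (`…DeligneSerreLiftProofs`, Deligne–Serre 6.11 through `ι : ℚ̄_p ≃ ℂ`);
* (5)–(6) `ModularForms.exists_isNewform1_of_cuspidal_congruence` (`…CuspidalCongruenceProofs`,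
  with `exists_isNewform1_of_eigenpacket_prime_level` for the prime `M` and `T_p` in the Hecke
  family for the prime `p`).

Step (3) — that a modular form on `Γ₁(NM)` of nebentypus `ε₀` with `λ`-integral `q`-expansion,
all of whose constant terms at all cusps lie in `λ`, is congruent modulo `λ` to a CUSP form of the
same weight, level AND nebentypus — is not in the tree.  Its published status: the reduction is a
cuspidal Katz form by the `q`-expansion principle (N. M. Katz, *p-adic properties of modular schemes
and modular forms*, LNM 350 (1973), 1.6–1.7; F. Diamond, J. Im, *Modular forms and modular curves*
(1995), Thm. 12.3.2, Rem. 12.3.5, Thm. 12.3.7 — the argument written out in Billerey–Menares 2018,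
§3.1, p. 13: "the `q`-expansion principle allows us to ensure that `f` is a cuspidal eigenform"),
and a cuspidal Katz form of weight `k ≥ 2` and level `NM ≥ 5` prime to `p` lifts to a cusp form on
`Γ₁(NM)` over `𝒪` (Katz, op. cit., Thm. 1.7.1); the lift has the exact nebentypus `ε₀` when
`p ∤ φ(NM)` (the `ε₀`-projector `φ(NM)⁻¹ ∑ ε₀(d)⁻¹⟨d⟩` is then integral), and in general this last
point is the Eisenstein analogue of Carayol's lemma (H. Carayol, Duke Math. J. 59 (1989), Prop. 3;
F. Diamond, *The refined conjecture of Serre* (1995), Lemma 2.1 — both stated for IRREDUCIBLE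
residual representations), used implicitly by the printed proof ("According to [DeSe74] we can find
a form `f ∈ S_k(Γ₀(Np), ε₀)`").  Following the precedent of `…InertiaProofs`, this file proves the
named fact FROM that input stated as an explicit hypothesis (`hC`, quantified over all the data, in
the vocabulary of the tree: `ModularForms.eisensteinLevelRaised`, `ModularForms.nebentypusSubspace`,
`ModularForms.cuspCoeff`) — no new definition and no new named fact are introduced — one prime at a
time (`BillereyMenares2016_thm22_at_prime`), whence the named fact for every odd prime from `hC` at
every odd prime (`BillereyMenares2016_thm22_exists_newform_odd_of_cuspidalCongruence`) and the named
fact `BillereyMenares2016_thm22_exists_newform` (`p ≥ 5`) from `hC` at the primes `p ≥ 5` only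
(`BillereyMenares2016_thm22_exists_newform_of_cuspidalCongruence`), where the exact-nebentypus lift
is covered by the cited literature whenever `p ∤ φ(NM)`.

## References

* N. Billerey, R. Menares, *On the modularity of reducible mod `l` Galois representations*, Math.
  Res. Lett. 23 (2016), 15–41, §2, Thm. 2.2 (p. 7), Prop. 1.2. [BillereyMenares2016]
* P. Deligne, J.-P. Serre, *Formes modulaires de poids 1*, Ann. Sci. ÉNS (4) 7 (1974), 507–530,
  Lemme 6.11. [DeligneSerreASENS1974]
* L. C. Washington, *Introduction to Cyclotomic Fields*, GTM 83 (1997), Thm. 5.10, §5.3.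
  [Washington1997]
* N. Billerey, R. Menares, *Strong modularity of reducible Galois representations*, Trans. AMS 370
  (2018), §3.1 (p. 13). [BillereyMenares2018]
* N. M. Katz, *p-adic properties of modular schemes and modular forms*, in Modular Functions of One
  Variable III, LNM 350 (1973), 1.6–1.7. [Katz1973]
* H. Carayol, *Sur les représentations galoisiennes modulo `l` attachées aux formes modulaires*,
  Duke Math. J. 59 (1989), 785–801, Prop. 3. [Carayol1989]
-/

noncomputable section

open Literature.NumberTheory.GaloisRepresentations Literature.NumberTheory.EllipticCurves.ModularForms
open NumberField IsDedekindDomain Field Filter UpperHalfPlane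
open scoped MatrixGroups ModularForm Topology

namespace Literature.NumberTheory.EllipticCurves

set_option maxHeartbeats 400000 in
/-- **Billerey–Menares 2016, Thm. 2.2 at ONE odd prime `p`, from the cuspidality of the reduction of
`E - E(M·)` at that prime.**  Hypothesis `hC` (the one step of the printed proof not in the tree,
see the module docstring): for `ι : ℚ̄_p ≃ ℂ`, a primitive Dirichlet character `χ` modulo `N`
(`p ∤ N`) of order prime to `p` with `χ(-1) = (-1)^k`, a Billerey–Menares weight
`k ∈ {p, p + 1} ∪ [3, p - 1]`, a prime `M ∤ Np` with `χ(M)M^k ≡ 1 (mod 𝔪)`, IF all the constant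
terms of `E = eisensteinLevelRaised N k χ M` (`= E_k^{𝟙,χ} - E_k^{𝟙,χ}(M·)`) at all cusps lie in
`𝔪`, THEN some cusp form `f₀ ∈ S_k(NM, χ)` has `aₙ(f₀) ≡ aₙ(E) (mod 𝔪)` for all `n`.  Conclusion:
the body of the named fact `BillereyMenares2016_thm22_exists_newform_odd` at the prime `p`
(verbatim; the von Staudt clause indexed by `(p - 1) ∣ k`).
[cite: BillereyMenares2016, §2, Thm. 2.2 (p. 7); Prop. 1.2] [cite: DeligneSerreASENS1974, Lemme 6.11]
[cite: Washington1997, Thm. 5.10, §5.3] -/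
theorem BillereyMenares2016_thm22_at_prime {p : ℕ} [Fact p.Prime] (hp2 : p ≠ 2)
    (hC : ∀ (ι : PadicAlgCl p ≃+* ℂ) (N : ℕ) [NeZero N] (χ : DirichletCharacter ℂ N) (k : ℕ)
      (hk : 3 ≤ k) (M : ℕ) [NeZero M],
      χ.IsPrimitive → χ (-1) = (-1) ^ k → ¬ p ∣ N → M.Prime → ¬ M ∣ N → M ≠ p →
      (∃ m : ℕ, 0 < m ∧ ¬ p ∣ m ∧ χ ^ m = 1) →
      (k = p ∨ k = p + 1 ∨ (3 ≤ k ∧ k + 1 ≤ p)) →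
      Valued.v (ι.symm ((χ (M : ZMod N) : ℂ) * (M : ℂ) ^ (k : ℤ)) - 1) < 1 →
      (∀ γ : SL(2, ℤ), ∃ c : ℂ,
        Tendsto ((⇑(eisensteinLevelRaised N k χ M hk) : ℍ → ℂ) ∣[(k : ℤ)] γ) atImInfty (𝓝 c) ∧
          Valued.v (ι.symm c) < 1) →
      ∃ f₀ : CuspForm (CongruenceSubgroup.Gamma1 (N * M)) k,
        f₀ ∈ nebentypusSubspace (N * M) k (DirichletCharacter.changeLevel (dvd_mul_right N M) χ) ∧
        ∀ n, Valued.v (ι.symm (cuspCoeff f₀ n -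
          (qExpansion 1 ⇑(eisensteinLevelRaised N k χ M hk)).coeff n)) < 1)
    (ι : PadicAlgCl p ≃+* ℂ) (θ : absoluteGaloisGroup ℚ →ₜ* (PadicAlgCl p)ˣ) (k M : ℕ)
    (hunit : ∀ τ, Valued.v ((θ τ : (PadicAlgCl p)ˣ) : PadicAlgCl p) = 1)
    (hodd : ∀ c : absoluteGaloisGroup ℚ, IsComplexConjugation (Rat.castHom ℝ) c →
      Valued.v (((θ c : (PadicAlgCl p)ˣ) : PadicAlgCl p) + 1) < 1)
    (hk : k = p ∨ k = p + 1 ∨ (3 ≤ k ∧ k + 1 ≤ p))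
    (hinertia : ∀ w : HeightOneSpectrum (𝓞 ℚ), (p : 𝓞 ℚ) ∈ w.asIdeal → ∃ 𝔓 ∈ w.primesAbove,
      ∀ σ ∈ 𝔓.inertia (absoluteGaloisGroup ℚ),
        Valued.v (((θ σ : (PadicAlgCl p)ˣ) : PadicAlgCl p) -
          algebraMap (Padic p) (PadicAlgCl p)
            (((GaloisRep.cyclotomicCharacter ℚ p σ).val : PadicInt p) : Padic p) ^ (k - 1)) < 1)
    (hM : M.Prime) (hMp : M ≠ p)
    (hunr : ∀ w : HeightOneSpectrum (𝓞 ℚ), (M : 𝓞 ℚ) ∈ w.asIdeal → ∀ 𝔓 ∈ w.primesAbove,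
      ∀ σ ∈ 𝔓.inertia (absoluteGaloisGroup ℚ),
        Valued.v (((θ σ : (PadicAlgCl p)ˣ) : PadicAlgCl p) - 1) < 1)
    (hfrob : ∀ w : HeightOneSpectrum (𝓞 ℚ), (M : 𝓞 ℚ) ∈ w.asIdeal → ∀ 𝔓 ∈ w.primesAbove,
      ∀ σ : absoluteGaloisGroup ℚ, IsArithFrobAt (𝓞 ℚ) σ 𝔓 →
        Valued.v (((θ σ : (PadicAlgCl p)ˣ) : PadicAlgCl p) * (M : PadicAlgCl p) - 1) < 1)
    (hvs : (p - 1) ∣ k →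
      (∀ τ : absoluteGaloisGroup ℚ, Valued.v (((θ τ : (PadicAlgCl p)ˣ) : PadicAlgCl p) -
        algebraMap (Padic p) (PadicAlgCl p)
          (((GaloisRep.cyclotomicCharacter ℚ p τ).val : PadicInt p) : Padic p) ^ (k - 1)) < 1) →
      M ^ (p - 1) % p ^ 2 = 1) :
    ∃ (N : ℕ) (_ : NeZero N) (g : CuspForm (CongruenceSubgroup.Gamma1 N) k),
      IsNewform1 g ∧ ¬ p ∣ N ∧
      (N = (nebentypus g).conductor ∨ N = (nebentypus g).conductor * M) ∧
      (∃ m : ℕ, 0 < m ∧ ¬ p ∣ m ∧ nebentypus g ^ m = 1) ∧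
      Valued.v (ι.symm ((qExpansion 1 ⇑g).coeff p) - 1) < 1 ∧
      ∀ ℓ : ℕ, ℓ.Prime → ¬ ℓ ∣ N → ℓ ≠ p →
        ∀ w : HeightOneSpectrum (𝓞 ℚ), (ℓ : 𝓞 ℚ) ∈ w.asIdeal → ∀ 𝔓 ∈ w.primesAbove,
          ∀ σ : absoluteGaloisGroup ℚ, IsArithFrobAt (𝓞 ℚ) σ 𝔓 →
            Valued.v (ι.symm ((qExpansion 1 ⇑g).coeff ℓ) -
                (1 + ((θ σ : (PadicAlgCl p)ˣ) : PadicAlgCl p))) < 1 ∧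
            Valued.v (ι.symm ((nebentypus g (ℓ : ZMod N) : ℂ) * (ℓ : ℂ) ^ ((k : ℤ) - 1)) -
                ((θ σ : (PadicAlgCl p)ˣ) : PadicAlgCl p)) < 1 := by
  have hp : p.Prime := Fact.out
  have hp3 : 3 ≤ p := by have := hp.two_le; omega
  have hk3 : 3 ≤ k := by rcases hk with h | h | h <;> omega
  have hk1 : 1 ≤ k := by omega
  -- ### (0) the dictionary `η ↦ (N, χ)`
  obtain ⟨N, _, χ, hχ, hpN, hpar, ⟨m, hm0, hm, hχm⟩, hτ, hℓ, hMd⟩ :=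
    exists_dirichletCharacter_of_padicCharacter hp3 ι θ hk1 hunit hodd
      ⟨_, natCast_mem_asIdeal_primesEquiv_symm p hp,
        hinertia _ (natCast_mem_asIdeal_primesEquiv_symm p hp)⟩
  obtain ⟨hMN, hMc⟩ := hMd M hM hMp hunr
  have hcong := hMc hfrob
  haveI : NeZero M := ⟨hM.ne_zero⟩
  -- ### (1)–(2) all constant terms of `E - E(M·)` vanish modulo `𝔪`
  have hconst : ∀ γ : SL(2, ℤ), ∃ c : ℂ,
      Tendsto ((⇑(eisensteinLevelRaised N k χ M hk3) : ℍ → ℂ) ∣[(k : ℤ)] γ) atImInfty (𝓝 c) ∧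
        Valued.v (ι.symm c) < 1 := by
    refine exists_tendsto_eisensteinLevelRaised_slash_valuation_lt_one_odd k χ M ι hp2 hpN hχ
      hk3 hk hM hMp ((Nat.Prime.coprime_iff_not_dvd hM).2 hMN) hcong ?_
    -- the von Staudt clause: at level `N = 1`, `θ ≡ χ_p^{k-1}` on all of `Γ_ℚ`
    intro hdvd hN1
    subst hN1
    refine hvs hdvd fun τ ↦ ?_
    have h1 := hτ τ
    have hχ1 : ∀ x : ZMod 1, χ x = 1 := fun x ↦ by rw [Subsingleton.elim x 1, map_one]
    rw [hχ1, map_one, one_mul] at h1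
    rwa [Valuation.map_sub_swap] at h1
  -- ### (3) the cuspidal congruence (hypothesis `hC`), (4)–(6) the newform
  obtain ⟨f₀, hf₀, hcongr⟩ := hC ι N χ k hk3 M hχ hpar hpN hM hMN hMp ⟨m, hm0, hm, hχm⟩ hk hcong
    hconst
  obtain ⟨N', _, hNN', g, hnew, hlevel, hneb, hcg⟩ :=
    exists_isNewform1_of_cuspidal_congruence ι hχ hk3 hpar hm hχm hM hMN hMp hf₀ hcongr
  -- ### bookkeeping
  have hpN' : ¬ p ∣ N' := by
    rcases hlevel with rfl | rfl
    · exact hpN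
    · intro h
      rcases (Nat.Prime.dvd_mul hp).1 h with h1 | h1
      · exact hpN h1
      · exact hMp ((Nat.prime_dvd_prime_iff_eq hp hM).1 h1).symm
  have hcond : (nebentypus g).conductor = N := by
    rw [hneb, DirichletCharacter.conductor_changeLevel]
    exact hχ
  have hχv : ∀ j : ZMod N, Valued.v (ι.symm (χ j)) ≤ 1 := fun j ↦
    valuation_ringEquiv_symm_apply_le_one χ ι j
  refine ⟨N', ‹NeZero N'›, g, hnew, hpN', ?_, ⟨m, hm0, hm, ?_⟩, ?_, ?_⟩
  · rw [hcond]; exact hlevel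
  · rw [hneb, ← map_pow, hχm, map_one]
  · -- `a_p(g) ≡ 1 + χ(p) p^{k-1} ≡ 1`
    have h1 := hcg p hp hpN'
    have h2 : Valued.v (ι.symm (χ p * (p : ℂ) ^ ((k : ℤ) - 1))) < 1 := by
      rw [show ((k : ℤ) - 1) = ((k - 1 : ℕ) : ℤ) by omega, zpow_natCast, map_mul, map_pow,
        map_natCast ι.symm, Valuation.map_mul, Valuation.map_pow]
      obtain ⟨j, hj⟩ : ∃ j, k - 1 = j + 1 := ⟨k - 2, by omega⟩
      rw [hj, pow_succ]
      calc Valued.v (ι.symm (χ p)) * (Valued.v (p : PadicAlgCl p) ^ j * Valued.v (p : PadicAlgCl p))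
          ≤ 1 * (1 * Valued.v (p : PadicAlgCl p)) :=
          mul_le_mul' (hχv _) (mul_le_mul' (pow_le_one' valuation_natCast_padicAlgCl_self_lt_one.le _)
            le_rfl)
        _ < 1 := by rw [one_mul, one_mul]; exact valuation_natCast_padicAlgCl_self_lt_one
    change Valued.v (ι.symm (cuspCoeff g p) - 1) < 1
    have h3 : ι.symm (cuspCoeff g p) - 1 =
        (ι.symm (cuspCoeff g p) - ι.symm (1 + χ p * (p : ℂ) ^ ((k : ℤ) - 1))) +
          ι.symm (χ p * (p : ℂ) ^ ((k : ℤ) - 1)) := by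
      rw [map_add, map_one]; ring
    rw [h3]
    exact (Valuation.map_add _ _ _).trans_lt (max_lt h1 h2)
  · intro ℓ hℓp hℓN' hℓp' w hw 𝔓 h𝔓 σ hσ
    have hℓN : ¬ ℓ ∣ N := fun h ↦ hℓN' (h.trans hNN')
    have h1 := hcg ℓ hℓp hℓN'
    have h2 := hℓ ℓ hℓp hℓN hℓp' w hw 𝔓 h𝔓 σ hσ
    constructor
    · change Valued.v (ι.symm (cuspCoeff g ℓ) - (1 + ((θ σ : (PadicAlgCl p)ˣ) : PadicAlgCl p))) < 1
      have h3 : ι.symm (cuspCoeff g ℓ) - (1 + ((θ σ : (PadicAlgCl p)ˣ) : PadicAlgCl p)) =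
          (ι.symm (cuspCoeff g ℓ) - ι.symm (1 + χ ℓ * (ℓ : ℂ) ^ ((k : ℤ) - 1))) +
            (ι.symm (χ ℓ * (ℓ : ℂ) ^ ((k : ℤ) - 1)) - ((θ σ : (PadicAlgCl p)ˣ) : PadicAlgCl p)) := by
        rw [map_add, map_one]; ring
      rw [h3]
      exact (Valuation.map_add _ _ _).trans_lt (max_lt h1 h2)
    · -- the nebentypus of `g` at `ℓ` is `χ(ℓ)`
      have hneqℓ : nebentypus g (ℓ : ZMod N') = χ (ℓ : ZMod N) := by
        rw [hneb]
        have hcop : IsCoprime (ℓ : ℤ) ((N' : ℕ) : ℤ) :=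
          Nat.isCoprime_iff_coprime.mpr ((Nat.Prime.coprime_iff_not_dvd hℓp).2 hℓN')
        have h := DirichletCharacter.changeLevel_eq_cast_of_dvd' χ hNN' hcop
        rw [Int.cast_natCast, Int.cast_natCast] at h
        exact h
      rw [hneqℓ]
      exact h2


/-- **Billerey–Menares 2016, Thm. 2.2 (every odd prime), from the cuspidality of the reduction of
`E - E(M·)`.**  Hypothesis `hC` (the one step of the printed proof not in the tree; Katz 1973,
1.6–1.7, Diamond–Im 1995, §12.3, Carayol's lemma): for an odd prime `p`, `ι : ℚ̄_p ≃ ℂ`, a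
primitive Dirichlet character `χ` modulo `N` (`p ∤ N`) of order prime to `p` with
`χ(-1) = (-1)^k`, a Billerey–Menares weight `k ∈ {p, p + 1} ∪ [3, p - 1]`, a prime `M ∤ Np` with
`χ(M)M^k ≡ 1 (mod 𝔪)`, IF all the constant terms of `E = eisensteinLevelRaised N k χ M`
(`= E_k^{𝟙,χ} - E_k^{𝟙,χ}(M·)`) at all cusps lie in `𝔪`, THEN some cusp form `f₀ ∈ S_k(NM, χ)`
has `aₙ(f₀) ≡ aₙ(E) (mod 𝔪)` for all `n`.  Conclusion: the named fact
`BillereyMenares2016_thm22_exists_newform_odd`. [cite: BillereyMenares2016, §2, Thm. 2.2 (p. 7); Prop. 1.2]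
[cite: DeligneSerreASENS1974, Lemme 6.11] [cite: Washington1997, Thm. 5.10, §5.3] -/
theorem BillereyMenares2016_thm22_exists_newform_odd_of_cuspidalCongruence
    (hC : ∀ (p : ℕ) [Fact p.Prime] (ι : PadicAlgCl p ≃+* ℂ) (N : ℕ) [NeZero N]
      (χ : DirichletCharacter ℂ N) (k : ℕ) (hk : 3 ≤ k) (M : ℕ) [NeZero M],
      p ≠ 2 → χ.IsPrimitive → χ (-1) = (-1) ^ k → ¬ p ∣ N → M.Prime → ¬ M ∣ N → M ≠ p →
      (∃ m : ℕ, 0 < m ∧ ¬ p ∣ m ∧ χ ^ m = 1) →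
      (k = p ∨ k = p + 1 ∨ (3 ≤ k ∧ k + 1 ≤ p)) →
      Valued.v (ι.symm ((χ (M : ZMod N) : ℂ) * (M : ℂ) ^ (k : ℤ)) - 1) < 1 →
      (∀ γ : SL(2, ℤ), ∃ c : ℂ,
        Tendsto ((⇑(eisensteinLevelRaised N k χ M hk) : ℍ → ℂ) ∣[(k : ℤ)] γ) atImInfty (𝓝 c) ∧
          Valued.v (ι.symm c) < 1) →
      ∃ f₀ : CuspForm (CongruenceSubgroup.Gamma1 (N * M)) k,
        f₀ ∈ nebentypusSubspace (N * M) k (DirichletCharacter.changeLevel (dvd_mul_right N M) χ) ∧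
        ∀ n, Valued.v (ι.symm (cuspCoeff f₀ n -
          (qExpansion 1 ⇑(eisensteinLevelRaised N k χ M hk)).coeff n)) < 1) :
    BillereyMenares2016_thm22_exists_newform_odd :=
  fun p _ hp2 ι θ k M hunit hodd hk hinertia hM hMp hunr hfrob hvs ↦
    BillereyMenares2016_thm22_at_prime hp2 (fun ι N _ χ k hk M _ ↦ hC p ι N χ k hk M hp2) ι θ k M
      hunit hodd hk hinertia hM hMp hunr hfrob hvs

/-- **Billerey–Menares 2016, Thm. 2.2 for `p ≥ 5` (the named fact
`BillereyMenares2016_thm22_exists_newform`), from the cuspidality of the reduction of `E - E(M·)` at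
the primes `p ≥ 5` only** — the range in which the exact-nebentypus lift of a cuspidal reduction
is covered by the cited literature whenever `p ∤ φ(NM)` (module docstring).  The von Staudt clause
of the `p ≥ 5` fact is indexed by `k + 1 = p`, which on the Billerey–Menares weights is
`(p - 1) ∣ k` (`prime_sub_one_dvd_weight_iff`). [cite: BillereyMenares2016, §2, Thm. 2.2 (p. 7); Prop. 1.2]
[cite: DeligneSerreASENS1974, Lemme 6.11] [cite: Washington1997, Thm. 5.10, §5.3] -/
theorem BillereyMenares2016_thm22_exists_newform_of_cuspidalCongruence
    (hC : ∀ (p : ℕ) [Fact p.Prime] (ι : PadicAlgCl p ≃+* ℂ) (N : ℕ) [NeZero N]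
      (χ : DirichletCharacter ℂ N) (k : ℕ) (hk : 3 ≤ k) (M : ℕ) [NeZero M],
      5 ≤ p → χ.IsPrimitive → χ (-1) = (-1) ^ k → ¬ p ∣ N → M.Prime → ¬ M ∣ N → M ≠ p →
      (∃ m : ℕ, 0 < m ∧ ¬ p ∣ m ∧ χ ^ m = 1) →
      (k = p ∨ k = p + 1 ∨ (3 ≤ k ∧ k + 1 ≤ p)) →
      Valued.v (ι.symm ((χ (M : ZMod N) : ℂ) * (M : ℂ) ^ (k : ℤ)) - 1) < 1 →
      (∀ γ : SL(2, ℤ), ∃ c : ℂ,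
        Tendsto ((⇑(eisensteinLevelRaised N k χ M hk) : ℍ → ℂ) ∣[(k : ℤ)] γ) atImInfty (𝓝 c) ∧
          Valued.v (ι.symm c) < 1) →
      ∃ f₀ : CuspForm (CongruenceSubgroup.Gamma1 (N * M)) k,
        f₀ ∈ nebentypusSubspace (N * M) k (DirichletCharacter.changeLevel (dvd_mul_right N M) χ) ∧
        ∀ n, Valued.v (ι.symm (cuspCoeff f₀ n -
          (qExpansion 1 ⇑(eisensteinLevelRaised N k χ M hk)).coeff n)) < 1) :
    BillereyMenares2016_thm22_exists_newform :=
  fun p _ hp5 ι θ k M hunit hodd hk hinertia hM hMp hunr hfrob hvs ↦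
    BillereyMenares2016_thm22_at_prime (by omega) (fun ι N _ χ k hk M _ ↦ hC p ι N χ k hk M hp5)
      ι θ k M hunit hodd hk hinertia hM hMp hunr hfrob
      (fun hdvd ↦ hvs ((prime_sub_one_dvd_weight_iff hp5 hk).mp hdvd))

end Literature.NumberTheory.EllipticCurves
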